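import Mathlib
import Literature.Computability.Complexity.RangeAvoidance
import Literature.Computability.Complexity.SignDegreeXor
import Summits.PneNP.PneNP.Theorems.PstarIsolation
import Summits.PneNP.PneNP.Theorems.PstarIsolationBound
import Summits.PneNP.PneNP.Theorems.PstarIsolationRobust

/-!
# Isolation of the all-ones range point of a pure `P⋆` local map — localisation to connected vertex sets

FRONTIER range-avoidance ladder, rung F-N3(ψ) (cell `pnp-ideate`, ROUND-19/20, mechanism M19; restricted-model
algorithmics — nothing here bears on `P` vs `NP`).

The isolation theorems of `PstarIsolationBound` (K2) and `PstarIsolationRobust` (K2⁺) assume the pseudo-randomness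
inequalities for EVERY vertex set `U`.  This file proves that they are needed only for the vertex sets that are
CONNECTED in the variable co-occurrence (shadow) hypergraph of the instance — the structural first step ("`U` is WLOG
connected") of the defect-tolerant programme S1 of ROUND-19 §6:

* `flipped_union` / `disjoint_flipped`: if no output reads both `U₁` and `U₂` (`Separated`), then
  `Ψ(U₁ ∪ U₂) = Ψ(U₁) ⊔ Ψ(U₂)` — the flipped set is additive over separated parts (for pure `P⋆` maps);
* `exists_connected_part`: every output `i ∈ Ψ(U)` lies in `Ψ(W)` for some shadow-connected part `W ⊆ U` that is
  separated from `U \ W`, with `Ψ(W) ⊆ Ψ(U)`;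
* `onesFlip_not_mem_range_of_local` (and `…_localW`): `1ᵐ ⊕ e_i` is outside the range as soon as the five
  inequalities of `PseudoRandom (1/50) 2` (resp. the six of `PseudoRandomW (1/50) 2 2`) hold at every
  shadow-connected `W` with `i ∈ Ψ(W)` (`m ≥ 900 n`, resp. `m ≥ 1600 n`); in particular the promises restricted to
  connected non-empty sets already give `AllOnesIsolated` (`allOnesIsolated_of_connected`, `…_connectedW`).

Connectedness is defined elementarily (`ShadowConnected`: no proper non-empty part is separated from the rest); no
graph library is used.
-/

set_option linter.dupNamespace false

open Finset Literature.Computability.Complexity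
open Summit.PneNP.PneNP.Theorems.PstarIsolation
open Summit.PneNP.PneNP.Theorems.PstarIsolationBound (AllOnesIsolated PseudoRandom)
open Summit.PneNP.PneNP.Theorems.PstarIsolationRobust (PseudoRandomW flipInequalityA)

namespace Summit.PneNP.PneNP.Theorems.PstarIsolationLocal

variable {n m : ℕ}

/-! ## Separated vertex sets and additivity of the flipped set -/

/-- Output `j` reads some variable of `U`. -/
def Touches (I : LocalMap 4 n m) (j : Fin m) (U : Finset (Fin n)) : Prop := ∃ s : Fin 4, I.vars j s ∈ U

/-- No output reads both a variable of `U₁` and a variable of `U₂`. -/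
def Separated (I : LocalMap 4 n m) (U₁ U₂ : Finset (Fin n)) : Prop :=
  ∀ j : Fin m, Touches I j U₁ → ¬Touches I j U₂

/-- `W` is connected in the variable co-occurrence (shadow) hypergraph of `I`: no proper non-empty part of `W` is
separated from the rest of `W`. -/
def ShadowConnected (I : LocalMap 4 n m) (W : Finset (Fin n)) : Prop :=
  ∀ W₁, W₁ ⊆ W → W₁.Nonempty → W₁ ≠ W → ¬Separated I W₁ (W \ W₁)

/-- Touching is monotone in the vertex set. -/
theorem Touches.mono {I : LocalMap 4 n m} {j : Fin m} {U V : Finset (Fin n)} (h : Touches I j U) (hUV : U ⊆ V) :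
    Touches I j V := by
  obtain ⟨s, hs⟩ := h
  exact ⟨s, hUV hs⟩

/-- Separation is symmetric. -/
theorem Separated.symm {I : LocalMap 4 n m} {U₁ U₂ : Finset (Fin n)} (h : Separated I U₁ U₂) :
    Separated I U₂ U₁ := fun j h₂ h₁ => h j h₁ h₂

/-- Separation passes to subsets. -/
theorem Separated.mono {I : LocalMap 4 n m} {U₁ U₂ V₁ V₂ : Finset (Fin n)} (h : Separated I U₁ U₂)
    (h₁ : V₁ ⊆ U₁) (h₂ : V₂ ⊆ U₂) : Separated I V₁ V₂ := fun j hj₁ hj₂ => h j (hj₁.mono h₁) (hj₂.mono h₂)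

/-- Nothing touches the empty set. -/
theorem not_touches_empty (I : LocalMap 4 n m) (j : Fin m) : ¬Touches I j ∅ := fun ⟨_, hs⟩ => by simp at hs

/-- Every set is separated from the empty set. -/
theorem separated_empty (I : LocalMap 4 n m) (U : Finset (Fin n)) : Separated I U ∅ :=
  fun j _ h => not_touches_empty I j h

/-- The value of output `j` at `1 − 1_U` depends only on which of its slots lie in `U`. -/
theorem eval_gauge_congr (I : LocalMap 4 n m) (U U' : Finset (Fin n)) (j : Fin m)
    (h : ∀ s, I.vars j s ∈ U ↔ I.vars j s ∈ U') : I.eval (gauge U) j = I.eval (gauge U') j := by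
  simp only [LocalMap.eval, PstarIsolation.gauge]
  congr 1
  funext s
  by_cases hs : I.vars j s ∈ U
  · have hs' : I.vars j s ∈ U' := (h s).1 hs
    simp [hs, hs']
  · have hs' : I.vars j s ∉ U' := fun h' => hs ((h s).2 h')
    simp [hs, hs']

/-- Membership in `Ψ(U)` depends only on which slots of the output lie in `U`. -/
theorem mem_flipped_congr (I : LocalMap 4 n m) (U U' : Finset (Fin n)) (j : Fin m)
    (h : ∀ s, I.vars j s ∈ U ↔ I.vars j s ∈ U') : j ∈ flipped I U ↔ j ∈ flipped I U' := by
  simp only [flipped, Finset.mem_filter, Finset.mem_univ, true_and, eval_gauge_congr I U U' j h]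

/-- `Ψ(∅) = ∅` for a pure `P⋆` map. -/
theorem flipped_empty (I : LocalMap 4 n m) (hI : I.IsPure xorAndPred) : flipped I ∅ = ∅ := by
  ext j
  have hg : gauge (∅ : Finset (Fin n)) = fun _ => true := by
    funext v; simp [PstarIsolation.gauge]
  simp only [flipped, hg, Finset.mem_filter, Finset.mem_univ, true_and, Finset.notMem_empty, iff_false,
    Bool.not_eq_false]
  exact congrFun (eval_ones I hI) j

/-- An output reading no variable of `U` is not flipped by `U`. -/
theorem not_mem_flipped_of_not_touches (I : LocalMap 4 n m) (hI : I.IsPure xorAndPred) (U : Finset (Fin n))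
    (j : Fin m) (h : ¬Touches I j U) : j ∉ flipped I U := by
  have h' : ∀ s, I.vars j s ∈ U ↔ I.vars j s ∈ (∅ : Finset (Fin n)) :=
    fun s => ⟨fun hs => (h ⟨s, hs⟩).elim, fun hs => by simp at hs⟩
  rw [mem_flipped_congr I U ∅ j h', flipped_empty I hI]
  simp

/-- A flipped output reads some variable of `U`. -/
theorem touches_of_mem_flipped (I : LocalMap 4 n m) (hI : I.IsPure xorAndPred) (U : Finset (Fin n)) (j : Fin m)
    (h : j ∈ flipped I U) : Touches I j U := by
  by_contra ht
  exact not_mem_flipped_of_not_touches I hI U j ht h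

/-- **Additivity of the flipped set over separated parts**: `Ψ(U₁ ∪ U₂) = Ψ(U₁) ∪ Ψ(U₂)`. -/
theorem flipped_union (I : LocalMap 4 n m) (hI : I.IsPure xorAndPred) (U₁ U₂ : Finset (Fin n))
    (hsep : Separated I U₁ U₂) : flipped I (U₁ ∪ U₂) = flipped I U₁ ∪ flipped I U₂ := by
  ext j
  rw [Finset.mem_union]
  by_cases h₂ : Touches I j U₂
  · have h₁ : ¬Touches I j U₁ := fun h₁ => hsep j h₁ h₂
    have hc : ∀ s, I.vars j s ∈ U₁ ∪ U₂ ↔ I.vars j s ∈ U₂ := fun s =>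
      ⟨fun hs => (Finset.mem_union.1 hs).resolve_left fun hs₁ => h₁ ⟨s, hs₁⟩,
        fun hs => Finset.mem_union_right _ hs⟩
    rw [mem_flipped_congr I _ _ j hc]
    have := not_mem_flipped_of_not_touches I hI U₁ j h₁
    tauto
  · have hc : ∀ s, I.vars j s ∈ U₁ ∪ U₂ ↔ I.vars j s ∈ U₁ := fun s =>
      ⟨fun hs => (Finset.mem_union.1 hs).resolve_right fun hs₂ => h₂ ⟨s, hs₂⟩,
        fun hs => Finset.mem_union_left _ hs⟩
    rw [mem_flipped_congr I _ _ j hc]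
    have := not_mem_flipped_of_not_touches I hI U₂ j h₂
    tauto

/-- … and the two parts flip disjoint output sets. -/
theorem disjoint_flipped (I : LocalMap 4 n m) (hI : I.IsPure xorAndPred) (U₁ U₂ : Finset (Fin n))
    (hsep : Separated I U₁ U₂) : Disjoint (flipped I U₁) (flipped I U₂) := by
  rw [Finset.disjoint_left]
  intro j h₁ h₂
  exact hsep j (touches_of_mem_flipped I hI U₁ j h₁) (touches_of_mem_flipped I hI U₂ j h₂)

/-- So `|Ψ(U₁ ∪ U₂)| = |Ψ(U₁)| + |Ψ(U₂)|` for separated parts. -/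
theorem card_flipped_union (I : LocalMap 4 n m) (hI : I.IsPure xorAndPred) (U₁ U₂ : Finset (Fin n))
    (hsep : Separated I U₁ U₂) : (flipped I (U₁ ∪ U₂)).card = (flipped I U₁).card + (flipped I U₂).card := by
  rw [flipped_union I hI U₁ U₂ hsep, Finset.card_union_of_disjoint (disjoint_flipped I hI U₁ U₂ hsep)]

/-! ## Every flipped output lives on a shadow-connected part -/

/-- A part closed in a closed part is closed. -/
theorem separated_sdiff_of_subset (I : LocalMap 4 n m) {W V U : Finset (Fin n)} (hWV : W ⊆ V)
    (hV : Separated I V (U \ V)) (hW : Separated I W (V \ W)) : Separated I W (U \ W) := by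
  intro j hjW ⟨s, hs⟩
  rw [Finset.mem_sdiff] at hs
  by_cases hwV : I.vars j s ∈ V
  · exact hW j hjW ⟨s, Finset.mem_sdiff.2 ⟨hwV, hs.2⟩⟩
  · exact hV j (hjW.mono hWV) ⟨s, Finset.mem_sdiff.2 ⟨hs.1, hwV⟩⟩

/-- **Localisation.** Every `i ∈ Ψ(U)` lies in `Ψ(W)` for a shadow-connected part `W ⊆ U` separated from `U \ W`,
and `Ψ(W) ⊆ Ψ(U)`. -/
theorem exists_connected_part (I : LocalMap 4 n m) (hI : I.IsPure xorAndPred) (i : Fin m) :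
    ∀ (N : ℕ) (U : Finset (Fin n)), U.card ≤ N → i ∈ flipped I U →
      ∃ W, W ⊆ U ∧ ShadowConnected I W ∧ Separated I W (U \ W) ∧ i ∈ flipped I W ∧
        flipped I W ⊆ flipped I U := by
  intro N
  induction N with
  | zero =>
      intro U hU hi
      have hU0 : U = ∅ := Finset.card_eq_zero.1 (Nat.le_zero.1 hU)
      subst hU0
      rw [flipped_empty I hI] at hi
      simp at hi
  | succ N ih =>
      intro U hU hi
      by_cases hc : ShadowConnected I U
      · refine ⟨U, Finset.Subset.refl U, hc, ?_, hi, Finset.Subset.refl _⟩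
        rw [Finset.sdiff_self]; exact separated_empty I U
      · unfold ShadowConnected at hc
        push Not at hc
        obtain ⟨W₁, hW₁U, hne, hneq, hsep⟩ := hc
        have hUeq : W₁ ∪ (U \ W₁) = U := Finset.union_sdiff_of_subset hW₁U
        have hflip : flipped I U = flipped I W₁ ∪ flipped I (U \ W₁) := by
          rw [← flipped_union I hI _ _ hsep, hUeq]
        have hlt₁ : W₁.card ≤ N := by
          have := Finset.card_lt_card (Finset.ssubset_iff_subset_ne.2 ⟨hW₁U, hneq⟩)
          omega
        have hlt₂ : (U \ W₁).card ≤ N := by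
          have h1 := Finset.card_sdiff_add_card_eq_card hW₁U
          have h2 := hne.card_pos
          omega
        have hi' := hi
        rw [hflip, Finset.mem_union] at hi'
        rcases hi' with hi₁ | hi₂
        · obtain ⟨W, hWsub, hconn, hsepW, hiW, hsubW⟩ := ih W₁ hlt₁ hi₁
          refine ⟨W, hWsub.trans hW₁U, hconn, separated_sdiff_of_subset I hWsub hsep hsepW, hiW, ?_⟩
          rw [hflip]; exact hsubW.trans Finset.subset_union_left
        · have hsep' : Separated I (U \ W₁) (U \ (U \ W₁)) := by
            rw [Finset.sdiff_sdiff_eq_self hW₁U]; exact hsep.symm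
          obtain ⟨W, hWsub, hconn, hsepW, hiW, hsubW⟩ := ih (U \ W₁) hlt₂ hi₂
          refine ⟨W, hWsub.trans Finset.sdiff_subset, hconn, separated_sdiff_of_subset I hWsub hsep' hsepW,
            hiW, ?_⟩
          rw [hflip]; exact hsubW.trans Finset.subset_union_right

/-! ## The promises at a single vertex set, and the flip bounds there -/

/-- The five inequalities of `PstarIsolationBound.PseudoRandom η κ` at ONE vertex set `U`. -/
def PseudoRandomAt (η κ : ℝ) (I : LocalMap 4 n m) (U : Finset (Fin n)) : Prop :=
  (volL I U : ℝ) ≤ (1 + η) * (2 * ((m : ℝ) / n)) * U.card ∧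
  (1 - η) * (2 * ((m : ℝ) / n)) * U.card ≤ (volA I U : ℝ) ∧
  (m : ℝ) / n ^ 2 * (U.card : ℝ) ^ 2 - κ * Real.sqrt ((m : ℝ) / n) * U.card ≤ (eL I U : ℝ) ∧
  (eA I U : ℝ) ≤ (m : ℝ) / n ^ 2 * (U.card : ℝ) ^ 2 + κ * Real.sqrt ((m : ℝ) / n) * U.card ∧
  (eLA I U : ℝ) ≤ 4 * ((m : ℝ) / n ^ 2 * (U.card : ℝ) ^ 2) + 2 * κ * Real.sqrt ((m : ℝ) / n) * U.card

/-- The six inequalities of `PstarIsolationRobust.PseudoRandomW η β κ` at ONE vertex set `U`. -/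
def PseudoRandomWAt (η β κ : ℝ) (I : LocalMap 4 n m) (U : Finset (Fin n)) : Prop :=
  (1 - η) * (4 * ((m : ℝ) / n)) * U.card ≤ (volL I U : ℝ) + volA I U ∧
  (volL I U : ℝ) - volA I U ≤ β * Real.sqrt ((m : ℝ) / n) * n ∧
  (m : ℝ) / n ^ 2 * (U.card : ℝ) ^ 2 - κ * Real.sqrt ((m : ℝ) / n) * U.card ≤ (eL I U : ℝ) ∧
  (eL I U : ℝ) ≤ (m : ℝ) / n ^ 2 * (U.card : ℝ) ^ 2 + κ * Real.sqrt ((m : ℝ) / n) * U.card ∧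
  (eA I U : ℝ) ≤ (m : ℝ) / n ^ 2 * (U.card : ℝ) ^ 2 + κ * Real.sqrt ((m : ℝ) / n) * U.card ∧
  (eLA I U : ℝ) ≤ 4 * ((m : ℝ) / n ^ 2 * (U.card : ℝ) ^ 2) + 2 * κ * Real.sqrt ((m : ℝ) / n) * U.card

/-- The global promise is the local one at every vertex set. -/
theorem pseudoRandom_iff (η κ : ℝ) (I : LocalMap 4 n m) : PseudoRandom η κ I ↔ ∀ U, PseudoRandomAt η κ I U :=
  Iff.rfl

/-- The global robust promise is the local one at every vertex set. -/
theorem pseudoRandomW_iff (η β κ : ℝ) (I : LocalMap 4 n m) :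
    PseudoRandomW η β κ I ↔ ∀ U, PseudoRandomWAt η β κ I U :=
  Iff.rfl

/-- The flip bound at one vertex set: `(78/50·C − 36·√C)·|U| ≤ 6·|Ψ(U)|`. -/
theorem flip_bound_at (I : LocalMap 4 n m) (hI : I.IsPure xorAndPred) (U : Finset (Fin n))
    (hR : PseudoRandomAt (1 / 50) 2 I U) :
    (78 / 50 * ((m : ℝ) / n) - 36 * Real.sqrt ((m : ℝ) / n)) * U.card ≤ 6 * ((flipped I U).card : ℝ) := by
  have hK : (6 * volA I U + 10 * eL I U : ℕ) ≤ 6 * (flipped I U).card + 6 * eA I U + 5 * volL I U + eLA I U :=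
    flipInequality n m I hI U
  have hK' : 6 * (volA I U : ℝ) + 10 * (eL I U : ℝ) ≤
      6 * ((flipped I U).card : ℝ) + 6 * (eA I U : ℝ) + 5 * (volL I U : ℝ) + (eLA I U : ℝ) := by
    exact_mod_cast hK
  obtain ⟨hvL, hvA, heL, heA, heLA⟩ := hR
  nlinarith [hvL, hvA, heL, heA, heLA, hK']

/-- At one non-empty vertex set, `m ≥ 900 n`: `54 ≤ |Ψ(U)|`. -/
theorem le_flipped_card_at (I : LocalMap 4 n m) (hI : I.IsPure xorAndPred) (hn : 0 < n) (hm : 900 * n ≤ m)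
    (U : Finset (Fin n)) (hU : U.Nonempty) (hR : PseudoRandomAt (1 / 50) 2 I U) : 54 ≤ (flipped I U).card := by
  have hu : (1 : ℝ) ≤ U.card := by exact_mod_cast hU.card_pos
  have hn' : (0 : ℝ) < n := by exact_mod_cast hn
  have hC : (900 : ℝ) ≤ (m : ℝ) / n := by
    rw [le_div_iff₀ hn']; exact_mod_cast hm
  set s : ℝ := Real.sqrt ((m : ℝ) / n) with hs
  have hs_sq : s ^ 2 = (m : ℝ) / n := Real.sq_sqrt (by positivity)
  have hs30 : 30 ≤ s := by
    have h9 : Real.sqrt 900 = 30 := by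
      rw [show (900 : ℝ) = 30 ^ 2 by norm_num]; exact Real.sqrt_sq (by norm_num)
    rw [← h9]; exact Real.sqrt_le_sqrt hC
  have hb := flip_bound_at I hI U hR
  have hpos : (324 : ℝ) ≤ 78 / 50 * ((m : ℝ) / n) - 36 * s := by
    rw [← hs_sq]
    nlinarith [mul_nonneg (sub_nonneg.2 hs30) (by positivity : (0 : ℝ) ≤ 78 / 50 * s + 54 / 5)]
  have hmono : (78 / 50 * ((m : ℝ) / n) - 36 * s) * 1 ≤ (78 / 50 * ((m : ℝ) / n) - 36 * s) * U.card :=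
    mul_le_mul_of_nonneg_left hu (by linarith)
  have h54 : (54 : ℝ) ≤ ((flipped I U).card : ℝ) := by linarith
  exact_mod_cast h54

/-- At one non-empty vertex set, robust promise, `m ≥ 1600 n`: `2 ≤ |Ψ(U)|` (two regimes as in K2⁺). -/
theorem two_le_flipped_card_W_at (I : LocalMap 4 n m) (hI : I.IsPure xorAndPred) (hn : 0 < n)
    (hm : 1600 * n ≤ m) (U : Finset (Fin n)) (hU : U.Nonempty) (hR : PseudoRandomWAt (1 / 50) 2 2 I U) :
    2 ≤ (flipped I U).card := by
  have hu : (1 : ℝ) ≤ U.card := by exact_mod_cast hU.card_pos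
  have hn' : (0 : ℝ) < n := by exact_mod_cast hn
  have hC : (1600 : ℝ) ≤ (m : ℝ) / n := by
    rw [le_div_iff₀ hn']; exact_mod_cast hm
  set s : ℝ := Real.sqrt ((m : ℝ) / n) with hs
  have hs_sq : s ^ 2 = (m : ℝ) / n := Real.sq_sqrt (by positivity)
  have hs0 : 0 ≤ s := Real.sqrt_nonneg _
  have hs40 : 40 ≤ s := by
    have h16 : Real.sqrt 1600 = 40 := by
      rw [show (1600 : ℝ) = 40 ^ 2 by norm_num]; exact Real.sqrt_sq (by norm_num)
    rw [← h16]; exact Real.sqrt_le_sqrt hC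
  have hss : 40 * s ≤ s ^ 2 := by rw [sq]; exact mul_le_mul_of_nonneg_right hs40 hs0
  obtain ⟨hocc, himb, heLlo, heLhi, heA, heLA⟩ := hR
  have hK : (6 * volA I U + 10 * eL I U : ℕ) ≤ 6 * (flipped I U).card + 6 * eA I U + 5 * volL I U + eLA I U :=
    flipInequality n m I hI U
  have hA : volL I U + volA I U ≤ (flipped I U).card + 2 * eL I U + eA I U + 2 * eLA I U :=
    flipInequalityA I hI U
  have hK' : 6 * (volA I U : ℝ) + 10 * (eL I U : ℝ) ≤
      6 * ((flipped I U).card : ℝ) + 6 * (eA I U : ℝ) + 5 * (volL I U : ℝ) + (eLA I U : ℝ) := by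
    exact_mod_cast hK
  have hA' : (volL I U : ℝ) + volA I U ≤
      ((flipped I U).card : ℝ) + 2 * (eL I U : ℝ) + eA I U + 2 * (eLA I U : ℝ) := by exact_mod_cast hA
  suffices h : (2 : ℝ) ≤ ((flipped I U).card : ℝ) by exact_mod_cast h
  by_cases hreg : 10 * (U.card : ℝ) ≤ 3 * n
  · have hQ : (m : ℝ) / n ^ 2 * (U.card : ℝ) ^ 2 ≤ 3 / 10 * ((m : ℝ) / n) * U.card := by
      have h1 : (m : ℝ) / n ^ 2 * (U.card : ℝ) ^ 2 = ((m : ℝ) / n * U.card) * ((U.card : ℝ) / n) := by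
        field_simp
      have h2 : (U.card : ℝ) / n ≤ 3 / 10 := by
        rw [div_le_iff₀ hn']; linarith
      have h3 : (0 : ℝ) ≤ (m : ℝ) / n * U.card := by positivity
      rw [h1]
      calc (m : ℝ) / n * U.card * ((U.card : ℝ) / n) ≤ (m : ℝ) / n * U.card * (3 / 10) :=
            mul_le_mul_of_nonneg_left h2 h3
        _ = 3 / 10 * ((m : ℝ) / n) * U.card := by ring
    have hb : (31 / 50 * ((m : ℝ) / n) - 14 * s) * U.card ≤ ((flipped I U).card : ℝ) := by
      linarith [hocc, heLhi, heA, heLA, hA', hQ]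
    have hpos : (2 : ℝ) ≤ 31 / 50 * ((m : ℝ) / n) - 14 * s := by
      rw [← hs_sq]; linarith [hss, hs40]
    have hmono : (31 / 50 * ((m : ℝ) / n) - 14 * s) * 1 ≤ (31 / 50 * ((m : ℝ) / n) - 14 * s) * U.card :=
      mul_le_mul_of_nonneg_left hu (by linarith)
    linarith
  · have hlt : 3 * (n : ℝ) < 10 * U.card := by linarith
    have hsn : (3 * n) * s ≤ (10 * U.card) * s := mul_le_mul_of_nonneg_right hlt.le hs0
    have hb : (49 / 25 * ((m : ℝ) / n) - 218 / 3 * s) * U.card ≤ 6 * ((flipped I U).card : ℝ) := by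
      linarith [hocc, himb, heLlo, heA, heLA, hK', hsn]
    have hpos : (12 : ℝ) ≤ 49 / 25 * ((m : ℝ) / n) - 218 / 3 * s := by
      rw [← hs_sq]; linarith [hss, hs40]
    have hmono : (49 / 25 * ((m : ℝ) / n) - 218 / 3 * s) * 1 ≤
        (49 / 25 * ((m : ℝ) / n) - 218 / 3 * s) * U.card :=
      mul_le_mul_of_nonneg_left hu (by linarith)
    linarith

/-! ## Isolation from the promises on connected vertex sets only -/

/-- A preimage `x` of `1ᵐ ⊕ e_i` has `i ∈ Ψ(zero set of x)` and `|Ψ(zero set of x)| = 1`. -/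
theorem mem_flipped_of_preimage (I : LocalMap 4 n m) (x : Fin n → Bool) (i : Fin m) (hx : I.eval x = onesFlip i) :
    i ∈ flipped I (univ.filter fun v => x v = false) := by
  simp only [flipped, gauge_zeroSet, hx, Finset.mem_filter, Finset.mem_univ, true_and]
  exact (onesFlip_eq_false_iff i i).2 rfl

/-- **Local isolation criterion.**  If the five inequalities of `PseudoRandom (1/50) 2` hold at every
shadow-connected vertex set `W` with `i ∈ Ψ(W)`, and `m ≥ 900 n`, then `1ᵐ ⊕ e_i` is outside the range. -/
theorem onesFlip_not_mem_range_of_local (I : LocalMap 4 n m) (hI : I.IsPure xorAndPred) (hn : 0 < n)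
    (hm : 900 * n ≤ m) (i : Fin m)
    (hloc : ∀ W : Finset (Fin n), ShadowConnected I W → i ∈ flipped I W → PseudoRandomAt (1 / 50) 2 I W) :
    onesFlip i ∉ I.range := by
  rintro ⟨x, hx⟩
  set U : Finset (Fin n) := univ.filter fun v => x v = false with hU
  have hcard : (flipped I U).card = 1 := flipped_card_of_preimage I x i hx
  have hi : i ∈ flipped I U := mem_flipped_of_preimage I x i hx
  obtain ⟨W, -, hconn, -, hiW, hsub⟩ := exists_connected_part I hI i U.card U le_rfl hi
  have hWne : W.Nonempty := by
    obtain ⟨s, hs⟩ := touches_of_mem_flipped I hI W i hiW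
    exact ⟨_, hs⟩
  have h54 := le_flipped_card_at I hI hn hm W hWne (hloc W hconn hiW)
  have hle : (flipped I W).card ≤ (flipped I U).card := Finset.card_le_card hsub
  omega

/-- **K2 from connected sets.**  The promise `PseudoRandom (1/50) 2` restricted to shadow-connected non-empty vertex
sets already isolates the all-ones range point (`m ≥ 900 n`). -/
theorem allOnesIsolated_of_connected (I : LocalMap 4 n m) (hI : I.IsPure xorAndPred) (hn : 0 < n)
    (hm : 900 * n ≤ m)
    (hloc : ∀ W : Finset (Fin n), ShadowConnected I W → W.Nonempty → PseudoRandomAt (1 / 50) 2 I W) :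
    AllOnesIsolated I := fun i =>
  onesFlip_not_mem_range_of_local I hI hn hm i fun W hW hiW =>
    hloc W hW (by
      obtain ⟨s, hs⟩ := touches_of_mem_flipped I hI W i hiW
      exact ⟨_, hs⟩)

/-- **Local isolation criterion, robust promise.**  If the six inequalities of `PseudoRandomW (1/50) 2 2` hold at
every shadow-connected vertex set `W` with `i ∈ Ψ(W)`, and `m ≥ 1600 n`, then `1ᵐ ⊕ e_i` is outside the range. -/
theorem onesFlip_not_mem_range_of_localW (I : LocalMap 4 n m) (hI : I.IsPure xorAndPred) (hn : 0 < n)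
    (hm : 1600 * n ≤ m) (i : Fin m)
    (hloc : ∀ W : Finset (Fin n), ShadowConnected I W → i ∈ flipped I W → PseudoRandomWAt (1 / 50) 2 2 I W) :
    onesFlip i ∉ I.range := by
  rintro ⟨x, hx⟩
  set U : Finset (Fin n) := univ.filter fun v => x v = false with hU
  have hcard : (flipped I U).card = 1 := flipped_card_of_preimage I x i hx
  have hi : i ∈ flipped I U := mem_flipped_of_preimage I x i hx
  obtain ⟨W, -, hconn, -, hiW, hsub⟩ := exists_connected_part I hI i U.card U le_rfl hi
  have hWne : W.Nonempty := by
    obtain ⟨s, hs⟩ := touches_of_mem_flipped I hI W i hiW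
    exact ⟨_, hs⟩
  have h2 := two_le_flipped_card_W_at I hI hn hm W hWne (hloc W hconn hiW)
  have hle : (flipped I W).card ≤ (flipped I U).card := Finset.card_le_card hsub
  omega

/-- **K2⁺ from connected sets.**  The robust promise restricted to shadow-connected non-empty vertex sets already
isolates the all-ones range point (`m ≥ 1600 n`). -/
theorem allOnesIsolated_of_connectedW (I : LocalMap 4 n m) (hI : I.IsPure xorAndPred) (hn : 0 < n)
    (hm : 1600 * n ≤ m)
    (hloc : ∀ W : Finset (Fin n), ShadowConnected I W → W.Nonempty → PseudoRandomWAt (1 / 50) 2 2 I W) :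
    AllOnesIsolated I := fun i =>
  onesFlip_not_mem_range_of_localW I hI hn hm i fun W hW hiW =>
    hloc W hW (by
      obtain ⟨s, hs⟩ := touches_of_mem_flipped I hI W i hiW
      exact ⟨_, hs⟩)

end Summit.PneNP.PneNP.Theorems.PstarIsolationLocal
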